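import Summits.CriticalPhenomena.CardyFormulaZ2.Theorems.CardyBoundaryCoulombGasStripClusterRatesReduction
import Summits.CriticalPhenomena.CardyFormulaZ2.Theorems.CardyBoundaryCoulombGasStripClusterRatesModulusUnique

/-!
# The γ₂-conjunct of `StripClusterRates` is EXACTLY the two-cluster Kac gap statement K₂

Support file for line `two-cluster-rate-is-stationary-gap` (crux `StripClusterRates`,
stmt-CriticalPhenomena-13878), lead c3. The crux is `∃ γ₁ γ₂, (rates) ∧ n·γ₁ → π/3 ∧ n·γ₂ → 2π`; the rates exist
unconditionally (support `StripRatesExist`, stmt-13879) and the γ₁-limit is a corollary of crux 4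
(`oneClusterKac_of_rectilinearCardy`). This file isolates what is left: the γ₂-limit, stated for EVERY family of
two-cluster rates (`TwoClusterKacHalf`, inlined), is EQUIVALENT to the registered spectral stub `stub_kacTwo` of lead -1
(= the skeleton's `RelaxationRateKac`: `n·(−log s(n)) → 2π` for every family of relaxation moduli `s(n)` of the
stationary connectivity chains `planarTransfer (Icc 0 n)`), by the landed RateIsGap theorem
`twoClusterRate_eq_relaxationRate` (p85698) and the uniqueness of rates (`tendsto_nhds_unique`) and of relaxation
moduli (`bi_relaxationModulus_unique`, p96918). Registered sub-goal `twoClusterKac_iff_kacTwo`. No definitions are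
introduced.
-/

noncomputable section

namespace Summit.CriticalPhenomena.CardyFormulaZ2.Cruxes.StripClusterRates.TwoClusterRateIsStationaryGap

open Filter Topology
open Literature.Probability.Percolation Literature.Probability.LatticeModels

/-- **γ₂-half of the crux ⟺ K₂.** The Kac limit `n·γ₂(n) → 2π` for every family `γ₂` of two-cluster lengthwise rates
(`γ₂(n) = lim_m −log P_{1/2}[two LR crossings of [0,m]×[0,n] in distinct clusters]/m`, `n ≥ 1`) holds if and only if
`n·(−log s(n)) → 2π` for every family `s` of relaxation moduli (second-largest eigenvalue moduli of the unmarked blocks of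
`planarTransfer (Finset.Icc 0 n)`, `n ≥ 1`). Both directions transport along `s(n) = e^{−γ₂(n)}`
(`twoClusterRate_eq_relaxationRate` + uniqueness of limits and of moduli). [cite: Cardy1998, eq. (bb)] -/
theorem twoClusterKac_iff_kacTwo :
    (∀ γ : ℕ → ℝ,
      (∀ n : ℕ, 1 ≤ n →
        Tendsto (fun m : ℕ ↦ -Real.log ((bondPercolation (zdGraph 2) half).real
          {ω | ∃ x₁ ∈ (leftSide m n : Set (Site 2)), ∃ y₁ ∈ (rightSide m n : Set (Site 2)),
            ∃ x₂ ∈ (leftSide m n : Set (Site 2)), ∃ y₂ ∈ (rightSide m n : Set (Site 2)),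
              ω ∈ openConnIn (rectangle m n : Set (Site 2)) x₁ y₁ ∧
              ω ∈ openConnIn (rectangle m n : Set (Site 2)) x₂ y₂ ∧
              ω ∉ openConnIn (rectangle m n : Set (Site 2)) x₁ x₂}) / (m : ℝ)) atTop (𝓝 (γ n))) →
      Tendsto (fun n : ℕ ↦ (n : ℝ) * γ n) atTop (𝓝 (2 * Real.pi))) ↔
    (∀ s : ℕ → ℝ,
      (∀ n : ℕ, 1 ≤ n →
        ((∃ (μ : ℂ) (v : PlanarRowState (Finset.Icc (0 : ℤ) n) → ℂ),
          (v ≠ 0 ∧ (∀ p, (∃ x, p.1.JoinedToStar x) → v p = 0) ∧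
            ∀ p, (∀ x, ¬ p.1.JoinedToStar x) →
              ∑ q, (planarTransfer (Finset.Icc (0 : ℤ) n) p q : ℂ) * v q = μ * v p) ∧
          μ ≠ 1 ∧ ‖μ‖ = s n) ∧
        ∀ (μ : ℂ) (v : PlanarRowState (Finset.Icc (0 : ℤ) n) → ℂ),
          (v ≠ 0 ∧ (∀ p, (∃ x, p.1.JoinedToStar x) → v p = 0) ∧
            ∀ p, (∀ x, ¬ p.1.JoinedToStar x) →
              ∑ q, (planarTransfer (Finset.Icc (0 : ℤ) n) p q : ℂ) * v q = μ * v p) →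
          μ ≠ 1 → ‖μ‖ ≤ s n)) →
      Tendsto (fun n : ℕ ↦ (n : ℝ) * -Real.log (s n)) atTop (𝓝 (2 * Real.pi))) := by
  have h₂ := twoClusterRate_eq_relaxationRate
  constructor
  · -- γ₂-half ⇒ K₂: a family of moduli `s` is `e^{-γ'(n)}` for the rates `γ'` of `h₂`
    intro H s hs
    let γ' : ℕ → ℝ := fun n => if hn : 1 ≤ n then (h₂ n hn).choose else 0
    have hγ' : ∀ n : ℕ, ∀ hn : 1 ≤ n, γ' n = (h₂ n hn).choose := fun n hn => dif_pos hn
    have hlim := H γ' (fun n hn => by rw [hγ' n hn]; exact (h₂ n hn).choose_spec.1)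
    refine hlim.congr' ?_
    filter_upwards [eventually_ge_atTop 1] with n hn
    have hmod := (h₂ n hn).choose_spec.2
    rw [← hγ' n hn] at hmod
    have hs' : s n = Real.exp (-γ' n) := bi_relaxationModulus_unique n (s n) (Real.exp (-γ' n)) (hs n hn) hmod
    rw [hs', Real.log_exp, neg_neg]
  · -- K₂ ⇒ γ₂-half: the moduli `e^{-γ(n)}` of any family of rates `γ` (rates are unique limits)
    intro K γ hγ
    have hmod : ∀ n : ℕ, 1 ≤ n →
        ((∃ (μ : ℂ) (v : PlanarRowState (Finset.Icc (0 : ℤ) n) → ℂ),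
          (v ≠ 0 ∧ (∀ p, (∃ x, p.1.JoinedToStar x) → v p = 0) ∧
            ∀ p, (∀ x, ¬ p.1.JoinedToStar x) →
              ∑ q, (planarTransfer (Finset.Icc (0 : ℤ) n) p q : ℂ) * v q = μ * v p) ∧
          μ ≠ 1 ∧ ‖μ‖ = Real.exp (-γ n)) ∧
        ∀ (μ : ℂ) (v : PlanarRowState (Finset.Icc (0 : ℤ) n) → ℂ),
          (v ≠ 0 ∧ (∀ p, (∃ x, p.1.JoinedToStar x) → v p = 0) ∧
            ∀ p, (∀ x, ¬ p.1.JoinedToStar x) →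
              ∑ q, (planarTransfer (Finset.Icc (0 : ℤ) n) p q : ℂ) * v q = μ * v p) →
          μ ≠ 1 → ‖μ‖ ≤ Real.exp (-γ n)) := by
      intro n hn
      obtain ⟨γ₀, hrate, hmod₀⟩ := h₂ n hn
      have heq : γ n = γ₀ := tendsto_nhds_unique (hγ n hn) hrate
      rw [heq]
      exact hmod₀
    have h := K (fun n => Real.exp (-γ n)) hmod
    refine h.congr' (Eventually.of_forall fun n => ?_)
    exact red_mul_neg_log_exp_neg n (γ n)

end Summit.CriticalPhenomena.CardyFormulaZ2.Cruxes.StripClusterRates.TwoClusterRateIsStationaryGap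

end
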